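import Literature.NumberTheory.Automorphic.LocalOrbitalMeasureSemisimple
import Literature.NumberTheory.Automorphic.UnitaryGroupArchUnimodular
import Literature.NumberTheory.Rogawski1990.AdelicStableConjugacy
import HarnessLib

/-!
# Archimedean centralisers are direct factors of adelic centralisers: archimedean orbital measures at EVERY semisimple rational class
(Platonov–Rapinchuk (1994), §5.1: `G_𝔸 = G_∞ × G_{𝔸_f}` restricts to centralisers; Rogawski (1990), §3.8 Prop. 3.8.1 (a) p. 27, §4.9 p. 54, §14.2 p. 232;
Deitmar–Echterhoff (2014), Thm. 1.5.3; Knapp (2002), Cor. 8.31)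

Topic `NumberTheory/Automorphic`, namespace `Literature.NumberTheory.Automorphic.UnitaryGroup`.  THEOREMS ONLY (no def, no instance, no named fact, no
`sorry`).  Archimedean twin of ★ `LocalCentralizerUnimodularOfAdelic` ∕ ★ `LocalOrbitalMeasureSemisimple` (row (β) = O6 of the F0/P3a line at the place
`∞`): the retraction pair `archToAdelic` ∕ `archPart` (★ `UnitaryGroupAdelicProduct`: `archPart ∘ archToAdelic = id`, `archToAdelic(G_∞)` commutes with
`ker archPart = U(H)(𝔸_f)`) restricts to centralisers (★ `isMulRightInvariant_centralizer_of_retraction`), so the archimedean centraliser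
`U(H)(L⁺ ⊗ ℝ)_{γ_∞}`, `γ_∞ = archPart (γ ⊗ 1) = cmRationalToArch γ` (★ `archPart_cmDatum_toAdelic`), is unimodular whenever the adelic one is:

* §1 (every rank, every `g₀ ∈ U(H)(𝔸)`) **`isMulRightInvariant_arch_centralizer_of_adelic`**;
* §2 ANISOTROPIC `H` (every rank, every rational `γ`; ★ `isMulRightInvariant_centralizer_cmDatum`) **`isMulRightInvariant_arch_centralizer_of_anisotropic`**,
  and `H ∈ M₃(L)` non-degenerate, `γ` SEMISIMPLE (★ `isMulRightInvariant_centralizer_toAdelic_of_isSemisimpleElt`)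
  **`isMulRightInvariant_arch_centralizer_of_isSemisimpleElt`**;
* §3 the ARCHIMEDEAN ORBITAL MEASURES (`G_∞` is unimodular, ★ `modularCharacterFun_arch_eq_one`; ★ `exists_smulInvariantMeasure_quotient_centralizer`):
  **`exists_archOrbitalMeasure_of_anisotropic`** (every rank, every rational class), **`exists_archOrbitalMeasure_of_isSemisimpleElt`** (rank 3, quasi-split
  `Φ₃` included), and the FAMILIES on `ConjClasses (U(H)(L⁺ ⊗ ℝ))` at the classes of the `γ_∞` (★ `exists_orbitalMeasureFamily_of_isMulRightInvariant`, ★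
  `isMulRightInvariant_centralizer_of_isConj`): **`exists_archOrbitalMeasureFamily_of_anisotropic`**, **`exists_archOrbitalMeasureFamily_of_isSemisimpleElt`** —
  complementing the regular-class families of ★ `UnitaryGroupArchUnimodular` with the central and SINGULAR semisimple classes.

## References
* V. Platonov, A. Rapinchuk, *Algebraic Groups and Number Theory* (1994), §5.1 [PlatonovRapinchuk1994].
* J. Rogawski, *Automorphic Representations of Unitary Groups in Three Variables* (1990), §3.8 Prop. 3.8.1 (a), §4.9 p. 54, §14.2 p. 232 [Rogawski1990].
* A. Deitmar, S. Echterhoff, *Principles of Harmonic Analysis*, 2nd ed. (2014), Thm. 1.5.3 [DeitmarEchterhoff2014].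
* A. Knapp, *Lie Groups Beyond an Introduction*, 2nd ed. (2002), VIII §2 Cor. 8.31 [Knapp2002].
-/

noncomputable section

open MeasureTheory Measure NumberField IsDedekindDomain Topology
open Literature.MeasureTheory.Group
open Literature.AlgebraicGeometry.ShimuraVarieties (hermForm)
open Literature.NumberTheory.Rogawski1990 (cmRationalToArch archPart_cmDatum_toAdelic)
open scoped Matrix MatrixGroups NNReal

namespace Literature.NumberTheory.Automorphic

namespace UnitaryGroup

variable (L : Type) [Field L] [NumberField L] [IsCMField L] {N : ℕ} (H : Matrix (Fin N) (Fin N) L)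
  [MeasurableSpace (cmDatum L N H).Adelic] [BorelSpace (cmDatum L N H).Adelic]
  [MeasurableSpace (arch (↥(maximalRealSubfield L)) L (IsCMField.complexConj L) N H)]
  [BorelSpace (arch (↥(maximalRealSubfield L)) L (IsCMField.complexConj L) N H)]

/-! ## §1 The archimedean centraliser is a direct factor of the adelic centraliser -/

/-- **Archimedean centraliser unimodularity from adelic centraliser unimodularity** (every rank, every `g₀ ∈ U(H)(𝔸_{L⁺})`): with
`γ_∞ = archPart g₀ ∈ U(H)(L⁺ ⊗ ℝ)`, if every Haar measure on `U(H)(𝔸)_{g₀}` is right invariant then so is every Haar measure on `U(H)(L⁺ ⊗ ℝ)_{γ_∞}`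
(★ `isMulRightInvariant_centralizer_of_retraction` for `ι = archToAdelic`, `π = archPart`: ★ `archPart_archToAdelic`, and `archToAdelic a` commutes with
every `g` with `archPart g = 1` since such `g = finAdelicToAdelic (finPart g)`, ★ `archToAdelic_mul_finAdelicToAdelic` ∕ ★ `commute_archToAdelic_finAdelicToAdelic`).
[cite: PlatonovRapinchuk1994, §5.1] [cite: Rogawski1990, §4.9 p. 54] -/
theorem isMulRightInvariant_arch_centralizer_of_adelic (g₀ : (cmDatum L N H).Adelic)
    (γinf : arch (↥(maximalRealSubfield L)) L (IsCMField.complexConj L) N H)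
    (hγinf : γinf = archPart (↥(maximalRealSubfield L)) L (IsCMField.complexConj L) N H g₀)
    (hZ : ∀ (ρ : Measure (Subgroup.centralizer ({g₀} : Set (cmDatum L N H).Adelic))) [ρ.IsHaarMeasure], ρ.IsMulRightInvariant)
    (ρinf : Measure (Subgroup.centralizer ({γinf} : Set (arch (↥(maximalRealSubfield L)) L (IsCMField.complexConj L) N H))))
    [ρinf.IsHaarMeasure] : ρinf.IsMulRightInvariant := by
  subst hγinf
  haveI : LocallyCompactSpace (adelicGroupData (↥(maximalRealSubfield L)) L (IsCMField.complexConj L) N H).Adelic :=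
    locallyCompactSpace_cmDatum_Adelic L N H
  haveI : SecondCountableTopology (adelicGroupData (↥(maximalRealSubfield L)) L (IsCMField.complexConj L) N H).Adelic :=
    secondCountableTopology_cmDatum_Adelic L N H
  haveI : T2Space (adelicGroupData (↥(maximalRealSubfield L)) L (IsCMField.complexConj L) N H).Adelic := t2Space_cmDatum_Adelic L N H
  letI : MeasurableSpace (adelicGroupData (↥(maximalRealSubfield L)) L (IsCMField.complexConj L) N H).Adelic := ‹MeasurableSpace (cmDatum L N H).Adelic›
  haveI : BorelSpace (adelicGroupData (↥(maximalRealSubfield L)) L (IsCMField.complexConj L) N H).Adelic := ‹BorelSpace (cmDatum L N H).Adelic›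
  have hcomm : ∀ (a : arch (↥(maximalRealSubfield L)) L (IsCMField.complexConj L) N H)
      (g : (adelicGroupData (↥(maximalRealSubfield L)) L (IsCMField.complexConj L) N H).Adelic),
      archPart (↥(maximalRealSubfield L)) L (IsCMField.complexConj L) N H g = 1 →
        archToAdelic (↥(maximalRealSubfield L)) L (IsCMField.complexConj L) N H a * g =
          g * archToAdelic (↥(maximalRealSubfield L)) L (IsCMField.complexConj L) N H a := by
    intro a g hg
    have hdec := archToAdelic_mul_finAdelicToAdelic (↥(maximalRealSubfield L)) L (IsCMField.complexConj L) N H g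
    rw [hg, map_one, one_mul] at hdec
    rw [← hdec]
    exact (commute_archToAdelic_finAdelicToAdelic (↥(maximalRealSubfield L)) L (IsCMField.complexConj L) N H a _).eq
  have key := isMulRightInvariant_centralizer_of_retraction _ _
    (continuous_archToAdelic (↥(maximalRealSubfield L)) L (IsCMField.complexConj L) N H)
    (continuous_archPart (↥(maximalRealSubfield L)) L (IsCMField.complexConj L) N H)
    (archPart_archToAdelic (↥(maximalRealSubfield L)) L (IsCMField.complexConj L) N H) hcomm g₀ hZ
  exact @key ρinf ‹_›

/-! ## §2 Anisotropic `H` (every rank) and semisimple `γ` (rank 3) -/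

/-- **For ANISOTROPIC `H` (every rank), every Haar measure on the archimedean centraliser `U(H)(L⁺ ⊗ ℝ)_{γ_∞}`, `γ_∞ = cmRationalToArch γ = γ ⊗ 1`, of a
RATIONAL `γ` is right invariant** — regular, central and SINGULAR `γ` alike (★ `isMulRightInvariant_centralizer_cmDatum`, §1, ★ `archPart_cmDatum_toAdelic`).
[cite: Rogawski1990, §4.9 p. 54] [cite: PlatonovRapinchuk1994, §5.1] -/
theorem isMulRightInvariant_arch_centralizer_of_anisotropic (hanis : ∀ x : Fin N → L, hermForm (cmConjRingHom L) H x x = 0 → x = 0)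
    (γ : (cmDatum L N H).Rational)
    (ρinf : Measure (Subgroup.centralizer ({cmRationalToArch L N H γ} : Set (arch (↥(maximalRealSubfield L)) L (IsCMField.complexConj L) N H))))
    [ρinf.IsHaarMeasure] : ρinf.IsMulRightInvariant :=
  isMulRightInvariant_arch_centralizer_of_adelic L H ((cmDatum L N H).toAdelic γ) _ (archPart_cmDatum_toAdelic L N H γ).symm
    (fun ρ _ => isMulRightInvariant_centralizer_cmDatum L N H hanis (γ := (cmDatum L N H).toAdelic γ) ⟨γ, rfl⟩ ρ) ρinf

omit [MeasurableSpace (cmDatum L N H).Adelic] [BorelSpace (cmDatum L N H).Adelic]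
  [MeasurableSpace (arch (↥(maximalRealSubfield L)) L (IsCMField.complexConj L) N H)]
  [BorelSpace (arch (↥(maximalRealSubfield L)) L (IsCMField.complexConj L) N H)] in
variable {L} in
/-- **For `H ∈ M₃(L)` hermitian non-degenerate (quasi-split `Φ₃` included), every Haar measure on `U(H)(L⁺ ⊗ ℝ)_{γ_∞}`, `γ_∞ = cmRationalToArch γ`, of a
SEMISIMPLE rational `γ` is right invariant** (★ `isMulRightInvariant_centralizer_toAdelic_of_isSemisimpleElt`, §1). [cite: Rogawski1990, §3.8 Prop. 3.8.1 p. 27]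
[cite: PlatonovRapinchuk1994, §5.1] -/
theorem isMulRightInvariant_arch_centralizer_of_isSemisimpleElt {H : Matrix (Fin 3) (Fin 3) L} (hH : (H.map (cmConjRingHom L))ᵀ = H)
    (hdet : H.det ≠ 0) (γ : (cmDatum L 3 H).Rational) (hss : Rogawski1990.IsSemisimpleElt (cmConjRingHom L) H γ)
    [MeasurableSpace (arch (↥(maximalRealSubfield L)) L (IsCMField.complexConj L) 3 H)]
    [BorelSpace (arch (↥(maximalRealSubfield L)) L (IsCMField.complexConj L) 3 H)]
    (ρinf : Measure (Subgroup.centralizer ({cmRationalToArch L 3 H γ} : Set (arch (↥(maximalRealSubfield L)) L (IsCMField.complexConj L) 3 H))))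
    [ρinf.IsHaarMeasure] : ρinf.IsMulRightInvariant := by
  borelize (cmDatum L 3 H).Adelic
  exact isMulRightInvariant_arch_centralizer_of_adelic L H ((cmDatum L 3 H).toAdelic γ) _ (archPart_cmDatum_toAdelic L 3 H γ).symm
    (fun ρ _ => isMulRightInvariant_centralizer_toAdelic_of_isSemisimpleElt hH hdet γ hss ρ) ρinf

/-! ## §3 Archimedean orbital measures and their families -/

omit [MeasurableSpace (cmDatum L N H).Adelic] [BorelSpace (cmDatum L N H).Adelic] in
/-- **Archimedean orbital measures at EVERY rational class of an anisotropic `U(H)`** (every rank; `H` hermitian non-degenerate, so that `G_∞` is unimodular, ★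
`modularCharacterFun_arch_eq_one`): for any Haar `ν` on `G_∞ = U(H)(L⁺ ⊗ ℝ)` there is a non-zero `G_∞`-invariant measure, finite on compact sets, on
`G_∞ ⧸ G_{∞, γ_∞}` (★ `exists_smulInvariantMeasure_quotient_centralizer`, the Haar measure of the centraliser being inversion invariant by §2).
[cite: Rogawski1990, §14.2 p. 232; §4.9 p. 54] [cite: DeitmarEchterhoff2014, Thm. 1.5.3] -/
theorem exists_archOrbitalMeasure_of_anisotropic (hanis : ∀ x : Fin N → L, hermForm (cmConjRingHom L) H x x = 0 → x = 0)
    (hH : (H.map (cmConjRingHom L))ᵀ = H) (hdet : H.det ≠ 0) (γ : (cmDatum L N H).Rational)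
    (ν : Measure (arch (↥(maximalRealSubfield L)) L (IsCMField.complexConj L) N H)) [ν.IsHaarMeasure]
    [MeasurableSpace (arch (↥(maximalRealSubfield L)) L (IsCMField.complexConj L) N H ⧸
      Subgroup.centralizer ({cmRationalToArch L N H γ} : Set (arch (↥(maximalRealSubfield L)) L (IsCMField.complexConj L) N H)))]
    [BorelSpace (arch (↥(maximalRealSubfield L)) L (IsCMField.complexConj L) N H ⧸
      Subgroup.centralizer ({cmRationalToArch L N H γ} : Set (arch (↥(maximalRealSubfield L)) L (IsCMField.complexConj L) N H)))] :
    ∃ m : Measure (arch (↥(maximalRealSubfield L)) L (IsCMField.complexConj L) N H ⧸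
        Subgroup.centralizer ({cmRationalToArch L N H γ} : Set (arch (↥(maximalRealSubfield L)) L (IsCMField.complexConj L) N H))),
      SMulInvariantMeasure (arch (↥(maximalRealSubfield L)) L (IsCMField.complexConj L) N H) _ m ∧ IsFiniteMeasureOnCompacts m ∧ m ≠ 0 := by
  borelize (cmDatum L N H).Adelic
  haveI : ν.IsMulRightInvariant := isMulRightInvariant_of_modularCharacterFun_eq_one (modularCharacterFun_arch_eq_one L H hH hdet) ν
  haveI : LocallyCompactSpace (Subgroup.centralizer ({cmRationalToArch L N H γ} : Set (arch (↥(maximalRealSubfield L)) L (IsCMField.complexConj L) N H))) :=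
    (isClosed_coe_centralizer_singleton _).isClosedEmbedding_subtypeVal.locallyCompactSpace
  haveI : SecondCountableTopology (Subgroup.centralizer ({cmRationalToArch L N H γ} :
      Set (arch (↥(maximalRealSubfield L)) L (IsCMField.complexConj L) N H))) := TopologicalSpace.Subtype.secondCountableTopology _
  haveI : (haar : Measure (Subgroup.centralizer ({cmRationalToArch L N H γ} :
      Set (arch (↥(maximalRealSubfield L)) L (IsCMField.complexConj L) N H)))).IsMulRightInvariant :=
    isMulRightInvariant_arch_centralizer_of_anisotropic L H hanis γ haar
  haveI : (haar : Measure (Subgroup.centralizer ({cmRationalToArch L N H γ} :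
      Set (arch (↥(maximalRealSubfield L)) L (IsCMField.complexConj L) N H)))).IsInvInvariant := isInvInvariant_of_isMulRightInvariant _
  obtain ⟨m, hinv, hreg, hne, -⟩ := exists_smulInvariantMeasure_quotient_centralizer (cmRationalToArch L N H γ) ν
    (haar : Measure (Subgroup.centralizer ({cmRationalToArch L N H γ} : Set (arch (↥(maximalRealSubfield L)) L (IsCMField.complexConj L) N H))))
  haveI := hreg
  exact ⟨m, hinv, inferInstance, hne⟩

omit [MeasurableSpace (cmDatum L N H).Adelic] [BorelSpace (cmDatum L N H).Adelic]
  [MeasurableSpace (arch (↥(maximalRealSubfield L)) L (IsCMField.complexConj L) N H)]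
  [BorelSpace (arch (↥(maximalRealSubfield L)) L (IsCMField.complexConj L) N H)] in
variable {L} in
/-- **Archimedean orbital measures at `γ_∞` for EVERY SEMISIMPLE rational `γ` of a rank-3 unitary group** (`H ∈ M₃(L)` hermitian non-degenerate; the
anisotropic inner forms AND the quasi-split `U(Φ₃)`; regular, scalar and singular classes alike). [cite: Rogawski1990, §14.2 p. 232; §4.9 p. 54]
[cite: DeitmarEchterhoff2014, Thm. 1.5.3] -/
theorem exists_archOrbitalMeasure_of_isSemisimpleElt {H : Matrix (Fin 3) (Fin 3) L} (hH : (H.map (cmConjRingHom L))ᵀ = H) (hdet : H.det ≠ 0)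
    (γ : (cmDatum L 3 H).Rational) (hss : Rogawski1990.IsSemisimpleElt (cmConjRingHom L) H γ)
    [MeasurableSpace (arch (↥(maximalRealSubfield L)) L (IsCMField.complexConj L) 3 H)]
    [BorelSpace (arch (↥(maximalRealSubfield L)) L (IsCMField.complexConj L) 3 H)]
    (ν : Measure (arch (↥(maximalRealSubfield L)) L (IsCMField.complexConj L) 3 H)) [ν.IsHaarMeasure]
    [MeasurableSpace (arch (↥(maximalRealSubfield L)) L (IsCMField.complexConj L) 3 H ⧸
      Subgroup.centralizer ({cmRationalToArch L 3 H γ} : Set (arch (↥(maximalRealSubfield L)) L (IsCMField.complexConj L) 3 H)))]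
    [BorelSpace (arch (↥(maximalRealSubfield L)) L (IsCMField.complexConj L) 3 H ⧸
      Subgroup.centralizer ({cmRationalToArch L 3 H γ} : Set (arch (↥(maximalRealSubfield L)) L (IsCMField.complexConj L) 3 H)))] :
    ∃ m : Measure (arch (↥(maximalRealSubfield L)) L (IsCMField.complexConj L) 3 H ⧸
        Subgroup.centralizer ({cmRationalToArch L 3 H γ} : Set (arch (↥(maximalRealSubfield L)) L (IsCMField.complexConj L) 3 H))),
      SMulInvariantMeasure (arch (↥(maximalRealSubfield L)) L (IsCMField.complexConj L) 3 H) _ m ∧ IsFiniteMeasureOnCompacts m ∧ m ≠ 0 := by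
  haveI : ν.IsMulRightInvariant := isMulRightInvariant_of_modularCharacterFun_eq_one (modularCharacterFun_arch_eq_one L H hH hdet) ν
  haveI : LocallyCompactSpace (Subgroup.centralizer ({cmRationalToArch L 3 H γ} : Set (arch (↥(maximalRealSubfield L)) L (IsCMField.complexConj L) 3 H))) :=
    (isClosed_coe_centralizer_singleton _).isClosedEmbedding_subtypeVal.locallyCompactSpace
  haveI : SecondCountableTopology (Subgroup.centralizer ({cmRationalToArch L 3 H γ} :
      Set (arch (↥(maximalRealSubfield L)) L (IsCMField.complexConj L) 3 H))) := TopologicalSpace.Subtype.secondCountableTopology _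
  haveI : (haar : Measure (Subgroup.centralizer ({cmRationalToArch L 3 H γ} :
      Set (arch (↥(maximalRealSubfield L)) L (IsCMField.complexConj L) 3 H)))).IsMulRightInvariant :=
    isMulRightInvariant_arch_centralizer_of_isSemisimpleElt hH hdet γ hss haar
  haveI : (haar : Measure (Subgroup.centralizer ({cmRationalToArch L 3 H γ} :
      Set (arch (↥(maximalRealSubfield L)) L (IsCMField.complexConj L) 3 H)))).IsInvInvariant := isInvInvariant_of_isMulRightInvariant _
  obtain ⟨m, hinv, hreg, hne, -⟩ := exists_smulInvariantMeasure_quotient_centralizer (cmRationalToArch L 3 H γ) ν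
    (haar : Measure (Subgroup.centralizer ({cmRationalToArch L 3 H γ} : Set (arch (↥(maximalRealSubfield L)) L (IsCMField.complexConj L) 3 H))))
  haveI := hreg
  exact ⟨m, hinv, inferInstance, hne⟩

omit [MeasurableSpace (cmDatum L N H).Adelic] [BorelSpace (cmDatum L N H).Adelic] in
/-- **The FAMILY of archimedean orbital measures at ALL rational classes of an anisotropic `U(H)`** (every rank; `H` hermitian non-degenerate):
`m : OrbitalMeasureFamily (U(H)(L⁺ ⊗ ℝ))` non-zero, invariant, regular and finite on compact sets at every class of `G_∞` containing some `γ ⊗ 1`, `γ`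
rational (★ `exists_orbitalMeasureFamily_of_isMulRightInvariant`; ★ `isMulRightInvariant_centralizer_of_isConj` moves §2 to the representative `out c`).
[cite: Rogawski1990, §14.2 p. 232; §4.9 p. 54] [cite: DeitmarEchterhoff2014, Thm. 1.5.3] -/
theorem exists_archOrbitalMeasureFamily_of_anisotropic (hanis : ∀ x : Fin N → L, hermForm (cmConjRingHom L) H x x = 0 → x = 0)
    (hH : (H.map (cmConjRingHom L))ᵀ = H) (hdet : H.det ≠ 0)
    [∀ g : arch (↥(maximalRealSubfield L)) L (IsCMField.complexConj L) N H,
      MeasurableSpace (arch (↥(maximalRealSubfield L)) L (IsCMField.complexConj L) N H ⧸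
        Subgroup.centralizer ({g} : Set (arch (↥(maximalRealSubfield L)) L (IsCMField.complexConj L) N H)))]
    [∀ g : arch (↥(maximalRealSubfield L)) L (IsCMField.complexConj L) N H,
      BorelSpace (arch (↥(maximalRealSubfield L)) L (IsCMField.complexConj L) N H ⧸
        Subgroup.centralizer ({g} : Set (arch (↥(maximalRealSubfield L)) L (IsCMField.complexConj L) N H)))] :
    ∃ m : OrbitalMeasureFamily (arch (↥(maximalRealSubfield L)) L (IsCMField.complexConj L) N H),
      ∀ c : ConjClasses (arch (↥(maximalRealSubfield L)) L (IsCMField.complexConj L) N H),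
        (∃ γ : (cmDatum L N H).Rational, ConjClasses.mk (cmRationalToArch L N H γ) = c) →
          m c ≠ 0 ∧
            SMulInvariantMeasure (arch (↥(maximalRealSubfield L)) L (IsCMField.complexConj L) N H)
              (arch (↥(maximalRealSubfield L)) L (IsCMField.complexConj L) N H ⧸
                Subgroup.centralizer ({(Quotient.out c : arch (↥(maximalRealSubfield L)) L (IsCMField.complexConj L) N H)} :
                  Set (arch (↥(maximalRealSubfield L)) L (IsCMField.complexConj L) N H))) (m c) ∧
            (m c).Regular ∧ IsFiniteMeasureOnCompacts (m c) := by
  borelize (cmDatum L N H).Adelic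
  have hP : ∀ g : arch (↥(maximalRealSubfield L)) L (IsCMField.complexConj L) N H,
      (∃ γ : (cmDatum L N H).Rational, IsConj (cmRationalToArch L N H γ) g) →
        ∀ (ρ : Measure (Subgroup.centralizer ({g} : Set (arch (↥(maximalRealSubfield L)) L (IsCMField.complexConj L) N H)))) [ρ.IsHaarMeasure],
          ρ.IsMulRightInvariant := by
    rintro g ⟨γ, hc⟩ ρ _
    exact isMulRightInvariant_centralizer_of_isConj hc (fun ρ' _ => isMulRightInvariant_arch_centralizer_of_anisotropic L H hanis γ ρ') ρ
  obtain ⟨m, hm⟩ := exists_orbitalMeasureFamily_of_isMulRightInvariant (modularCharacterFun_arch_eq_one L H hH hdet) _ hP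
  refine ⟨m, fun c ⟨γ, hc⟩ => hm c ⟨γ, ?_⟩⟩
  rw [← ConjClasses.mk_eq_mk_iff_isConj, hc, ← ConjClasses.quotient_mk_eq_mk, Quotient.out_eq]

omit [MeasurableSpace (cmDatum L N H).Adelic] [BorelSpace (cmDatum L N H).Adelic]
  [MeasurableSpace (arch (↥(maximalRealSubfield L)) L (IsCMField.complexConj L) N H)]
  [BorelSpace (arch (↥(maximalRealSubfield L)) L (IsCMField.complexConj L) N H)] in
variable {L} in
/-- **The FAMILY of archimedean orbital measures at the classes of the `γ_∞`, `γ` SEMISIMPLE rational, of a rank-3 unitary group** (`H ∈ M₃(L)` hermitian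
non-degenerate, quasi-split `Φ₃` included) — complementing the regular-class family ★ `exists_orbitalMeasureFamily_isRegularElt_arch` with the central and
singular semisimple classes. [cite: Rogawski1990, §14.2 p. 232; §4.9 p. 54] [cite: DeitmarEchterhoff2014, Thm. 1.5.3] -/
theorem exists_archOrbitalMeasureFamily_of_isSemisimpleElt {H : Matrix (Fin 3) (Fin 3) L} (hH : (H.map (cmConjRingHom L))ᵀ = H) (hdet : H.det ≠ 0)
    [MeasurableSpace (arch (↥(maximalRealSubfield L)) L (IsCMField.complexConj L) 3 H)]
    [BorelSpace (arch (↥(maximalRealSubfield L)) L (IsCMField.complexConj L) 3 H)]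
    [∀ g : arch (↥(maximalRealSubfield L)) L (IsCMField.complexConj L) 3 H,
      MeasurableSpace (arch (↥(maximalRealSubfield L)) L (IsCMField.complexConj L) 3 H ⧸
        Subgroup.centralizer ({g} : Set (arch (↥(maximalRealSubfield L)) L (IsCMField.complexConj L) 3 H)))]
    [∀ g : arch (↥(maximalRealSubfield L)) L (IsCMField.complexConj L) 3 H,
      BorelSpace (arch (↥(maximalRealSubfield L)) L (IsCMField.complexConj L) 3 H ⧸
        Subgroup.centralizer ({g} : Set (arch (↥(maximalRealSubfield L)) L (IsCMField.complexConj L) 3 H)))] :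
    ∃ m : OrbitalMeasureFamily (arch (↥(maximalRealSubfield L)) L (IsCMField.complexConj L) 3 H),
      ∀ c : ConjClasses (arch (↥(maximalRealSubfield L)) L (IsCMField.complexConj L) 3 H),
        (∃ γ : (cmDatum L 3 H).Rational, Rogawski1990.IsSemisimpleElt (cmConjRingHom L) H γ ∧ ConjClasses.mk (cmRationalToArch L 3 H γ) = c) →
          m c ≠ 0 ∧
            SMulInvariantMeasure (arch (↥(maximalRealSubfield L)) L (IsCMField.complexConj L) 3 H)
              (arch (↥(maximalRealSubfield L)) L (IsCMField.complexConj L) 3 H ⧸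
                Subgroup.centralizer ({(Quotient.out c : arch (↥(maximalRealSubfield L)) L (IsCMField.complexConj L) 3 H)} :
                  Set (arch (↥(maximalRealSubfield L)) L (IsCMField.complexConj L) 3 H))) (m c) ∧
            (m c).Regular ∧ IsFiniteMeasureOnCompacts (m c) := by
  have hP : ∀ g : arch (↥(maximalRealSubfield L)) L (IsCMField.complexConj L) 3 H,
      (∃ γ : (cmDatum L 3 H).Rational, Rogawski1990.IsSemisimpleElt (cmConjRingHom L) H γ ∧ IsConj (cmRationalToArch L 3 H γ) g) →
        ∀ (ρ : Measure (Subgroup.centralizer ({g} : Set (arch (↥(maximalRealSubfield L)) L (IsCMField.complexConj L) 3 H)))) [ρ.IsHaarMeasure],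
          ρ.IsMulRightInvariant := by
    rintro g ⟨γ, hss, hc⟩ ρ _
    exact isMulRightInvariant_centralizer_of_isConj hc (fun ρ' _ => isMulRightInvariant_arch_centralizer_of_isSemisimpleElt hH hdet γ hss ρ') ρ
  obtain ⟨m, hm⟩ := exists_orbitalMeasureFamily_of_isMulRightInvariant (modularCharacterFun_arch_eq_one L H hH hdet) _ hP
  refine ⟨m, fun c ⟨γ, hss, hc⟩ => hm c ⟨γ, hss, ?_⟩⟩
  rw [← ConjClasses.mk_eq_mk_iff_isConj, hc, ← ConjClasses.quotient_mk_eq_mk, Quotient.out_eq]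

end UnitaryGroup

end Literature.NumberTheory.Automorphic
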